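import Literature.Geometry.Lorentzian.KerrSchildEnergyCurrent
import HarnessLib

/-!
# Vector-field multiplier currents `J^X`, their bulk terms `K^X`, and the Lagrangian current
# for divergence-form wave operators on `ℝ⁴`

(family `gr`; infrastructure for the physical-space multiplier estimates behind statement
**gr.S24** — Dafermos–Rodnianski–Shlapentokh-Rothman, arXiv:1402.7034, §2.3 and §4 — in the
coefficient-field framework of `KerrSchild.waveOperator`; namespace
`Literature.Geometry.Lorentzian.KerrSchild`)

Dafermos–Rodnianski–Shlapentokh-Rothman (*Decay for solutions of the wave equation on Kerr exterior
spacetimes III*, arXiv:1402.7034 = Ann. of Math. 183 (2016)), §2.3.1, fix for a vector field `V`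
and a function `w` the currents
`J^V_μ[Ψ] = T_{μν}[Ψ] V^ν`, `J^{V,w}_μ[Ψ] = J^V_μ[Ψ] + ⅛ w ∂_μ(Ψ²) − ⅛ (∂_μ w) Ψ²`,
`K^V[Ψ] = T_{μν}[Ψ] ∇^μ V^ν`, with `T_{μν}[Ψ] = ∂_μΨ ∂_νΨ − ½ g_{μν} g^{αβ} ∂_αΨ ∂_βΨ`, and use the
divergence identity of §2.3.2 for them ("see [dr7] for more details": Dafermos–Rodnianski,
*Lectures on black holes and linear waves*, arXiv:0811.0354, App. D). Every physical-space
estimate of their §4 (the red-shift multiplier `N` of Prop. 4.5.1, the large-`r` current of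
Prop. 4.6.1) and of their §9 is an instance.

For a symmetric coefficient field `G = (G^{μν})` on `E4 = ℝ⁴` (in a chart with `det g = −1`, such
as the Kerr–Schild chart of Kerr, `∇_μ J^μ = ∂_μ J^μ` and `□_g = ∂_μ G^{μν} ∂_ν =
KerrSchild.waveOperator G`), a vector field given by its components `X : E4 → Fin 4 → ℝ` and a
function `w`, write `p_μ = ∂_μ w`, `A^μ = ∑_ν G^{μν} p_ν`, `X(w) = ∑_α X^α p_α`,
`Q = ∑_{αβ} G^{αβ} p_α p_β`. This file defines

* `KerrSchild.multiplierCurrent G X w x μ = A^μ X(w) − ½ X^μ Q` — the current `J^X` with its index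
  raised, `(J^X)^μ = T^μ{}_ν X^ν`;
* `KerrSchild.multiplierBulk G X w x =
    ∑_μ A^μ ∑_β (∂_μ X^β) p_β − ½ (∑_μ ∂_μ X^μ) Q − ½ ∑_μ X^μ ∑_{αβ} (∂_μ G^{αβ}) p_α p_β` — the bulk
  term `K^X` in these coordinates;
* `KerrSchild.lagrangianCurrent G ϖ w x μ = ϖ w A^μ − ½ w² ∑_ν G^{μν} ∂_ν ϖ` — the Lagrangian
  (zeroth-order) correction, so that `J^{X,ϖ} = J^X + ¼ · lagrangianCurrent G ϖ w` is the modified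
  current `J^{V,w}` of loc. cit.;

and **proves**

* `KerrSchild.sum_fderiv_multiplierCurrent` — the **divergence identity**
  `∑_μ ∂_μ (J^X)^μ = (□_G w) · X(w) + K^X` for `G` differentiable and symmetric at `x`, `X`
  differentiable at `x` and `w` of class `C²` at `x` (the second derivatives of `w` cancel by the
  symmetry of `G` and of `D²w`: `sum_cancel_multiplier_aux`);
* `KerrSchild.sum_fderiv_lagrangianCurrent` —
  `∑_μ ∂_μ (lagrangianCurrent)^μ = ϖ Q + ϖ w □_G w − ½ (□_G ϖ) w²`
  (so that `∇^μ J^{X,ϖ}_μ = K^X + ¼ ϖ ∇^αw ∇_αw − ⅛ (□ϖ) w² + (X(w) + ¼ ϖ w) □w`, the terms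
  `K^{V,w}`, `𝓔^{V,w}` of loc. cit.);
* the algebra used when multipliers are assembled from pieces and cut off:
  `multiplierCurrent_add`, `multiplierBulk_add` (`J^{X+Y} = J^X + J^Y`, `K^{X+Y} = K^X + K^Y`),
  `multiplierCurrent_smul`, `multiplierBulk_smul`
  (`J^{fX} = f J^X`, `K^{fX} = f K^X + (∑_μ A^μ ∂_μ f) X(w) − ½ X(f) Q`);
* the special cases already in the tree: `normalCurrent_eq_multiplierCurrent`,
  `deformationTerm_eq_multiplierBulk` (`X = (dt)♯`, i.e. `X^μ = G^{0μ}`: the current of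
  `KerrSchildEnergyCurrent.lean`, definitionally), `Kerr.tCurrent_eq_multiplierCurrent`
  (`X = ∂_{t*}` on Kerr, `KerrEnergyIdentity.lean`); and, for a coordinate vector field
  (`∂X = 0`), `multiplierBulk_of_fderiv_eq_zero`: `K^X = −½ ∑_μ X^μ (∂_μ G^{αβ}) p_α p_β`, whence
  `sum_fderiv_multiplierCurrent_timeTranslation`: **for a stationary coefficient field
  (`∂_0 G = 0`) the `∂_0`-energy current is conserved for solutions**,
  `∑_μ ∂_μ (J^{∂_0})^μ = (□_G w) ∂_0 w` (generalising `Kerr.sum_fderiv_tCurrent` from Kerr to every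
  stationary `G`).

Sign conventions: the identity is stated for the raised current and the coordinate divergence,
`∑_μ ∂_μ (J^X)^μ = (□_G w) X(w) + K^X`; integrated between two slices this is the energy identity
(ingeneralform) of DRSR §2.3.2 with bulk `K^X + (□_g w) X(w)`.

## References

* M. Dafermos, I. Rodnianski, Y. Shlapentokh-Rothman, arXiv:1402.7034 = Ann. of Math. 183 (2016),
  §2.3.1 (the currents `J^V`, `J^{V,w}`, `K^V`, `K^{V,w}`), §2.3.2 (the divergence identity)
  (key `DafermosRodnianskiShlapentokhrothman2014`).
* M. Dafermos, I. Rodnianski, *Lectures on black holes and linear waves*, arXiv:0811.0354, App. D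
  (`J^V_μ = T_{μν} V^ν`, `K^V = T_{μν} ∇^μ V^ν = ½ T^{μν} (𝓛_V g)_{μν}`, the modified currents)
  (key `DafermosRodnianski2008`).
* S. Alinhac, *Hyperbolic partial differential equations*, Springer 2009, Ch. 7 (the multiplier
  method for variable-coefficient wave equations in coordinates).
-/

noncomputable section

open Set Filter
open scoped ContDiff Topology

namespace Literature.Geometry.Lorentzian

namespace KerrSchild

/-! ### The objects -/

/-- The **current of a vector-field multiplier `X`** (components `X^α`) for the divergence-form wave
operator of a coefficient field `G`, with its index raised:
`(J^X)^μ = T^μ{}_ν[w] X^ν = (∑_ν G^{μν} ∂_νw)(∑_α X^α ∂_αw) − ½ X^μ ∑_{αβ} G^{αβ} ∂_αw ∂_βw`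
(DRSR arXiv:1402.7034, §2.3.1: `J^V_μ = T_{μν} V^ν`; Dafermos–Rodnianski arXiv:0811.0354, App. D).
[cite: DafermosRodnianskiShlapentokhrothman2014, §2.3.1] -/
def multiplierCurrent (G : E4 → Fin 4 → Fin 4 → ℝ) (X : E4 → Fin 4 → ℝ) (w : E4 → ℝ) (x : E4)
    (μ : Fin 4) : ℝ :=
  (∑ ν, G x μ ν * fderiv ℝ w x (E4.basisVector ν)) *
      (∑ α, X x α * fderiv ℝ w x (E4.basisVector α)) -
    2⁻¹ * X x μ *
      ∑ α, ∑ β, G x α β * fderiv ℝ w x (E4.basisVector α) * fderiv ℝ w x (E4.basisVector β)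

/-- The **bulk term `K^X`** of the multiplier `X` in coordinates with `det g = −1`: the quadratic
form in `dw`
`K^X = ∑_μ (∑_ν G^{μν}∂_νw)(∑_β ∂_μX^β ∂_βw) − ½ (∑_μ ∂_μX^μ) ∑_{αβ} G^{αβ}∂_αw∂_βw
 − ½ ∑_μ X^μ ∑_{αβ} ∂_μG^{αβ} ∂_αw ∂_βw`
(`K^V = T_{μν} ∇^μ V^ν = ½ T^{μν} (𝓛_V g)_{μν}` written out with `∂_μ(√|g|) = 0`; DRSR
arXiv:1402.7034, §2.3.1; Dafermos–Rodnianski arXiv:0811.0354, App. D).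
[cite: DafermosRodnianskiShlapentokhrothman2014, §2.3.1] -/
def multiplierBulk (G : E4 → Fin 4 → Fin 4 → ℝ) (X : E4 → Fin 4 → ℝ) (w : E4 → ℝ) (x : E4) : ℝ :=
  (∑ μ, (∑ ν, G x μ ν * fderiv ℝ w x (E4.basisVector ν)) *
      ∑ β, fderiv ℝ (fun y ↦ X y β) x (E4.basisVector μ) * fderiv ℝ w x (E4.basisVector β)) -
    2⁻¹ * (∑ μ, fderiv ℝ (fun y ↦ X y μ) x (E4.basisVector μ)) *
      (∑ α, ∑ β, G x α β * fderiv ℝ w x (E4.basisVector α) * fderiv ℝ w x (E4.basisVector β)) -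
    2⁻¹ * ∑ μ, X x μ * ∑ α, ∑ β, fderiv ℝ (fun y ↦ G y α β) x (E4.basisVector μ) *
      fderiv ℝ w x (E4.basisVector α) * fderiv ℝ w x (E4.basisVector β)

/-- The **Lagrangian current** of a weight `ϖ`, with its index raised:
`L^μ = ϖ w ∑_ν G^{μν} ∂_νw − ½ w² ∑_ν G^{μν} ∂_νϖ`, i.e. `L_μ = ½ ϖ ∂_μ(w²) − ½ (∂_μϖ) w²`, so
that the modified current of DRSR arXiv:1402.7034, §2.3.1,
`J^{V,ϖ}_μ = J^V_μ + ⅛ ϖ ∂_μ(w²) − ⅛ (∂_μϖ) w²`, is `J^V + ¼ L`.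
[cite: DafermosRodnianskiShlapentokhrothman2014, §2.3.1] -/
def lagrangianCurrent (G : E4 → Fin 4 → Fin 4 → ℝ) (ϖ w : E4 → ℝ) (x : E4) (μ : Fin 4) : ℝ :=
  ϖ x * w x * (∑ ν, G x μ ν * fderiv ℝ w x (E4.basisVector ν)) -
    2⁻¹ * w x ^ 2 * ∑ ν, G x μ ν * fderiv ℝ ϖ x (E4.basisVector ν)

/-! ### Elementary properties -/

/-- The current is quadratic in `dw`: it vanishes where `dw = 0`. [folklore] -/
theorem multiplierCurrent_eq_zero_of_fderiv_eq_zero (G : E4 → Fin 4 → Fin 4 → ℝ)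
    (X : E4 → Fin 4 → ℝ) {w : E4 → ℝ} {x : E4} (h : fderiv ℝ w x = 0) (μ : Fin 4) :
    multiplierCurrent G X w x μ = 0 := by
  simp [multiplierCurrent, h]

/-- The bulk term is quadratic in `dw`: it vanishes where `dw = 0`. [folklore] -/
theorem multiplierBulk_eq_zero_of_fderiv_eq_zero (G : E4 → Fin 4 → Fin 4 → ℝ)
    (X : E4 → Fin 4 → ℝ) {w : E4 → ℝ} {x : E4} (h : fderiv ℝ w x = 0) :
    multiplierBulk G X w x = 0 := by
  simp [multiplierBulk, h]

/-- The Lagrangian current vanishes where `w = 0`. [folklore] -/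
theorem lagrangianCurrent_eq_zero_of_eq_zero (G : E4 → Fin 4 → Fin 4 → ℝ) (ϖ : E4 → ℝ)
    {w : E4 → ℝ} {x : E4} (h : w x = 0) (μ : Fin 4) : lagrangianCurrent G ϖ w x μ = 0 := by
  simp [lagrangianCurrent, h]

/-- **`J^{X+Y} = J^X + J^Y`**: the current is additive in the multiplier. [folklore] -/
theorem multiplierCurrent_add (G : E4 → Fin 4 → Fin 4 → ℝ) (X Y : E4 → Fin 4 → ℝ) (w : E4 → ℝ)
    (x : E4) (μ : Fin 4) :
    multiplierCurrent G (X + Y) w x μ = multiplierCurrent G X w x μ + multiplierCurrent G Y w x μ := by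
  simp only [multiplierCurrent, Pi.add_apply, add_mul, Finset.sum_add_distrib]
  ring

/-- **`J^{fX} = f J^X`**: the current is `C⁰`-linear in the multiplier. [folklore] -/
theorem multiplierCurrent_smul (G : E4 → Fin 4 → Fin 4 → ℝ) (f : E4 → ℝ) (X : E4 → Fin 4 → ℝ)
    (w : E4 → ℝ) (x : E4) (μ : Fin 4) :
    multiplierCurrent G (fun y α ↦ f y * X y α) w x μ = f x * multiplierCurrent G X w x μ := by
  simp only [multiplierCurrent, mul_assoc, ← Finset.mul_sum]
  ring

/-- **`K^{X+Y} = K^X + K^Y`** (for multipliers differentiable at the point). [folklore] -/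
theorem multiplierBulk_add (G : E4 → Fin 4 → Fin 4 → ℝ) {X Y : E4 → Fin 4 → ℝ} (w : E4 → ℝ)
    {x : E4} (hX : ∀ α, DifferentiableAt ℝ (fun y ↦ X y α) x)
    (hY : ∀ α, DifferentiableAt ℝ (fun y ↦ Y y α) x) :
    multiplierBulk G (X + Y) w x = multiplierBulk G X w x + multiplierBulk G Y w x := by
  have hd : ∀ α, fderiv ℝ (fun y ↦ X y α + Y y α) x =
      fderiv ℝ (fun y ↦ X y α) x + fderiv ℝ (fun y ↦ Y y α) x :=
    fun α ↦ ((hX α).hasFDerivAt.add (hY α).hasFDerivAt).fderiv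
  simp only [multiplierBulk, Pi.add_apply, hd, add_apply]
  -- name the atoms and expand the finite sums
  obtain ⟨p, hp⟩ : ∃ p : Fin 4 → ℝ, ∀ β, fderiv ℝ w x (E4.basisVector β) = p β := ⟨_, fun _ ↦ rfl⟩
  obtain ⟨dX, hdX⟩ : ∃ dX : Fin 4 → Fin 4 → ℝ, ∀ μ β,
      fderiv ℝ (fun y ↦ X y β) x (E4.basisVector μ) = dX μ β := ⟨_, fun _ _ ↦ rfl⟩
  obtain ⟨dY, hdY⟩ : ∃ dY : Fin 4 → Fin 4 → ℝ, ∀ μ β,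
      fderiv ℝ (fun y ↦ Y y β) x (E4.basisVector μ) = dY μ β := ⟨_, fun _ _ ↦ rfl⟩
  obtain ⟨dG, hdG⟩ : ∃ dG : Fin 4 → Fin 4 → Fin 4 → ℝ, ∀ μ α β,
      fderiv ℝ (fun y ↦ G y α β) x (E4.basisVector μ) = dG μ α β := ⟨_, fun _ _ _ ↦ rfl⟩
  simp only [hp, hdX, hdY, hdG]
  simp only [Fin.sum_univ_four, Fin.isValue]
  ring

/-- **The bulk term of a cut-off multiplier**: for `f` and `X` differentiable at `x`,
`K^{fX} = f K^X + (∑_μ A^μ ∂_μf) X(w) − ½ X(f) Q` with `A^μ = ∑_ν G^{μν}∂_νw`,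
`X(w) = ∑_α X^α ∂_αw`, `X(f) = ∑_μ X^μ ∂_μ f`, `Q = ∑_{αβ} G^{αβ}∂_αw∂_βw` (the extra terms are
`T(∇f, X)`-type: `K^{fX} = f K^X + T(X, ∇f)`). [folklore] -/
theorem multiplierBulk_smul (G : E4 → Fin 4 → Fin 4 → ℝ) {f : E4 → ℝ} {X : E4 → Fin 4 → ℝ}
    (w : E4 → ℝ) {x : E4} (hf : DifferentiableAt ℝ f x)
    (hX : ∀ α, DifferentiableAt ℝ (fun y ↦ X y α) x) :
    multiplierBulk G (fun y α ↦ f y * X y α) w x =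
      f x * multiplierBulk G X w x +
        (∑ μ, (∑ ν, G x μ ν * fderiv ℝ w x (E4.basisVector ν)) *
            fderiv ℝ f x (E4.basisVector μ)) * (∑ α, X x α * fderiv ℝ w x (E4.basisVector α)) -
        2⁻¹ * (∑ μ, X x μ * fderiv ℝ f x (E4.basisVector μ)) *
          ∑ α, ∑ β, G x α β * fderiv ℝ w x (E4.basisVector α) * fderiv ℝ w x (E4.basisVector β) := by
  have hd : ∀ α, fderiv ℝ (fun y ↦ f y * X y α) x =
      f x • fderiv ℝ (fun y ↦ X y α) x + X x α • fderiv ℝ f x := fun α ↦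
    fderiv_mul hf (hX α)
  simp only [multiplierBulk, hd, add_apply, smul_apply, smul_eq_mul]
  -- name the atoms and expand the finite sums
  obtain ⟨p, hp⟩ : ∃ p : Fin 4 → ℝ, ∀ β, fderiv ℝ w x (E4.basisVector β) = p β := ⟨_, fun _ ↦ rfl⟩
  obtain ⟨dX, hdX⟩ : ∃ dX : Fin 4 → Fin 4 → ℝ, ∀ μ β,
      fderiv ℝ (fun y ↦ X y β) x (E4.basisVector μ) = dX μ β := ⟨_, fun _ _ ↦ rfl⟩
  obtain ⟨df, hdf⟩ : ∃ df : Fin 4 → ℝ, ∀ μ, fderiv ℝ f x (E4.basisVector μ) = df μ :=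
    ⟨_, fun _ ↦ rfl⟩
  obtain ⟨dG, hdG⟩ : ∃ dG : Fin 4 → Fin 4 → Fin 4 → ℝ, ∀ μ α β,
      fderiv ℝ (fun y ↦ G y α β) x (E4.basisVector μ) = dG μ α β := ⟨_, fun _ _ _ ↦ rfl⟩
  simp only [hp, hdX, hdf, hdG]
  simp only [Fin.sum_univ_four, Fin.isValue]
  ring

/-- **The bulk term of a coordinate vector field**: if `∂X = 0` at `x` then
`K^X = −½ ∑_μ X^μ ∑_{αβ} (∂_μ G^{αβ}) ∂_αw ∂_βw` (`= −½ (𝓛_X g⁻¹)(dw, dw)` for constant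
components). [folklore] -/
theorem multiplierBulk_of_fderiv_eq_zero (G : E4 → Fin 4 → Fin 4 → ℝ) {X : E4 → Fin 4 → ℝ}
    (w : E4 → ℝ) {x : E4} (hX : ∀ α, fderiv ℝ (fun y ↦ X y α) x = 0) :
    multiplierBulk G X w x =
      -(2⁻¹ * ∑ μ, X x μ * ∑ α, ∑ β, fderiv ℝ (fun y ↦ G y α β) x (E4.basisVector μ) *
        fderiv ℝ w x (E4.basisVector α) * fderiv ℝ w x (E4.basisVector β)) := by
  simp [multiplierBulk, hX]

/-! ### The special cases already in the tree -/

/-- The `dt`-current of `KerrSchildEnergyCurrent.lean` is the multiplier current of `X = (dt)♯`,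
`X^μ = G^{0μ}` (definitionally). [cite: DafermosRodnianski2008, App. D] -/
theorem normalCurrent_eq_multiplierCurrent (G : E4 → Fin 4 → Fin 4 → ℝ) (w : E4 → ℝ) (x : E4)
    (μ : Fin 4) : normalCurrent G w x μ = multiplierCurrent G (fun y ↦ G y 0) w x μ := rfl

/-- The deformation term of `KerrSchildEnergyCurrent.lean` is the bulk term of `X = (dt)♯`
(definitionally). [cite: DafermosRodnianski2008, App. D] -/
theorem deformationTerm_eq_multiplierBulk (G : E4 → Fin 4 → Fin 4 → ℝ) (w : E4 → ℝ) (x : E4) :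
    deformationTerm G w x = multiplierBulk G (fun y ↦ G y 0) w x := rfl

/-- The `∂_{t*}`-current of Kerr (`Kerr.tCurrent`, `KerrEnergyIdentity.lean`) is the multiplier
current of the coordinate vector field `∂_0` (components `δ^α_0`) for the Kerr inverse metric.
[cite: DafermosRodnianskiShlapentokhrothman2014, §2.3.1] -/
theorem _root_.Literature.Geometry.Lorentzian.Kerr.tCurrent_eq_multiplierCurrent (M a : ℝ)
    (Φ : E4 → ℝ) (x : E4) (μ : Fin 4) :
    Kerr.tCurrent M a Φ x μ =
      multiplierCurrent (Kerr.inverseMetric M a) (fun _ ν ↦ if ν = 0 then 1 else 0) Φ x μ := by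
  simp only [Kerr.tCurrent, multiplierCurrent, boole_mul, Finset.sum_ite_eq', Finset.mem_univ,
    if_true]
  split_ifs <;> ring

/-! ### The divergence identity -/

/-- The pure index algebra behind the cancellation of the second derivatives in
`∑_μ ∂_μ (J^X)^μ`: for symmetric `g` and `H` and any `P`, `X`,
`∑_μ (∑_ν g_{μν} P_ν)(∑_β X_β H_{μβ}) = ½ ∑_μ X_μ ∑_{αβ} (g_{αβ} P_α H_{μβ} + P_β g_{αβ} H_{μα})`.
[folklore] -/
theorem sum_cancel_multiplier_aux (g H : Fin 4 → Fin 4 → ℝ) (P X : Fin 4 → ℝ)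
    (hg : ∀ μ ν, g μ ν = g ν μ) (hH : ∀ μ ν, H μ ν = H ν μ) :
    ∑ μ, (∑ ν, g μ ν * P ν) * ∑ β, X β * H μ β =
      2⁻¹ * ∑ μ, X μ * ∑ α, ∑ β, (g α β * P α * H μ β + P β * (g α β * H μ α)) := by
  have g10 := hg 1 0; have g20 := hg 2 0; have g30 := hg 3 0
  have g21 := hg 2 1; have g31 := hg 3 1; have g32 := hg 3 2
  have H10 := hH 1 0; have H20 := hH 2 0; have H30 := hH 3 0
  have H21 := hH 2 1; have H31 := hH 3 1; have H32 := hH 3 2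
  simp only [Fin.sum_univ_four, Fin.isValue]
  rw [g10, g20, g30, g21, g31, g32, H10, H20, H30, H21, H31, H32]
  ring

/-- The pure index algebra of `∑_μ ∂_μ (J^X)^μ = (□w) X(w) + K^X`: with `g` the coefficients,
`dg μ α β` standing for `∂_μ g^{αβ}`, `X` for the multiplier and `dX μ β` for `∂_μ X^β`, `p` for
`dw`, `H` for `D²w` and `dA μ` for `∂_μ(∑_ν g^{μν} p_ν)`, the product-rule expansion of
`∑_μ ∂_μ (J^X)^μ` equals `(∑_μ dA_μ) X(w) + K^X` as soon as `g` and `H` are symmetric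
(`sum_cancel_multiplier_aux`). [folklore] -/
theorem sum_fderiv_multiplierCurrent_aux (g H : Fin 4 → Fin 4 → ℝ)
    (dg : Fin 4 → Fin 4 → Fin 4 → ℝ) (X : Fin 4 → ℝ) (dX : Fin 4 → Fin 4 → ℝ) (p dA : Fin 4 → ℝ)
    (hg : ∀ μ ν, g μ ν = g ν μ) (hH : ∀ μ ν, H μ ν = H ν μ) :
    ∑ μ, ((∑ ν, g μ ν * p ν) * ∑ ν, (X ν * H μ ν + p ν * dX μ ν) +
        (∑ α, X α * p α) * dA μ -
        (2⁻¹ * X μ * ∑ α, ∑ β, (g α β * p α * H μ β + p β * (g α β * H μ α + p α * dg μ α β)) +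
          (∑ α, ∑ β, g α β * p α * p β) * (2⁻¹ * dX μ μ))) =
      (∑ μ, dA μ) * (∑ α, X α * p α) +
        ((∑ μ, (∑ ν, g μ ν * p ν) * ∑ β, dX μ β * p β) -
          2⁻¹ * (∑ μ, dX μ μ) * (∑ α, ∑ β, g α β * p α * p β) -
          2⁻¹ * ∑ μ, X μ * ∑ α, ∑ β, dg μ α β * p α * p β) := by
  have hcancel := sum_cancel_multiplier_aux g H p X hg hH
  -- split the left-hand side into the cancelling part and the rest
  have hsplit : ∀ μ, (∑ ν, g μ ν * p ν) * ∑ ν, (X ν * H μ ν + p ν * dX μ ν) +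
      (∑ α, X α * p α) * dA μ -
      (2⁻¹ * X μ * ∑ α, ∑ β, (g α β * p α * H μ β + p β * (g α β * H μ α + p α * dg μ α β)) +
        (∑ α, ∑ β, g α β * p α * p β) * (2⁻¹ * dX μ μ)) =
      ((∑ ν, g μ ν * p ν) * ∑ β, X β * H μ β -
        2⁻¹ * (X μ * ∑ α, ∑ β, (g α β * p α * H μ β + p β * (g α β * H μ α)))) +
      ((∑ ν, g μ ν * p ν) * ∑ β, dX μ β * p β + dA μ * (∑ α, X α * p α) -
        2⁻¹ * dX μ μ * (∑ α, ∑ β, g α β * p α * p β) -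
        2⁻¹ * (X μ * ∑ α, ∑ β, dg μ α β * p α * p β)) := by
    intro μ
    have e1 : ∑ ν, (X ν * H μ ν + p ν * dX μ ν) =
        ∑ β, X β * H μ β + ∑ β, dX μ β * p β := by
      rw [← Finset.sum_add_distrib]
      exact Finset.sum_congr rfl fun β _ ↦ by ring
    have e2 : ∑ α, ∑ β, (g α β * p α * H μ β + p β * (g α β * H μ α + p α * dg μ α β)) =
        ∑ α, ∑ β, (g α β * p α * H μ β + p β * (g α β * H μ α)) +
          ∑ α, ∑ β, dg μ α β * p α * p β := by
      rw [← Finset.sum_add_distrib]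
      refine Finset.sum_congr rfl fun α _ ↦ ?_
      rw [← Finset.sum_add_distrib]
      exact Finset.sum_congr rfl fun β _ ↦ by ring
    rw [e1, e2]
    ring
  rw [Finset.sum_congr rfl fun μ _ ↦ hsplit μ, Finset.sum_add_distrib]
  have hC : ∑ μ, ((∑ ν, g μ ν * p ν) * ∑ β, X β * H μ β -
      2⁻¹ * (X μ * ∑ α, ∑ β, (g α β * p α * H μ β + p β * (g α β * H μ α)))) = 0 := by
    rw [Finset.sum_sub_distrib, ← Finset.mul_sum, hcancel, sub_self]
  rw [hC, zero_add, Finset.sum_sub_distrib, Finset.sum_sub_distrib, Finset.sum_add_distrib,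
    ← Finset.sum_mul, ← Finset.sum_mul, ← Finset.mul_sum, ← Finset.mul_sum]
  ring

/-- **The divergence identity for a vector-field multiplier.** For a coefficient field `G`
differentiable and symmetric at `x`, a multiplier `X` differentiable at `x` and `w` of class `C²`
at `x`,
`∑_μ ∂_μ (J^X)^μ (x) = (□_G w)(x) · X(w)(x) + K^X(x)`
with `□_G = KerrSchild.waveOperator G`, `X(w) = ∑_α X^α ∂_αw` and `K^X = KerrSchild.multiplierBulk`:
the coordinate form (`det g = −1`) of `∇^μ (T_{μν} X^ν) = (□_g w) X(w) + T_{μν} ∇^μ X^ν`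
(DRSR arXiv:1402.7034, §2.3.1–§2.3.2; Dafermos–Rodnianski arXiv:0811.0354, App. D), the terms
with `D²w` cancelling by the symmetry of `G` and of `D²w`.
[cite: DafermosRodnianskiShlapentokhrothman2014, §2.3.2] -/
theorem sum_fderiv_multiplierCurrent {G : E4 → Fin 4 → Fin 4 → ℝ} {X : E4 → Fin 4 → ℝ}
    {w : E4 → ℝ} {x : E4} (hG : ∀ μ ν, DifferentiableAt ℝ (fun y ↦ G y μ ν) x)
    (hsymm : ∀ μ ν, G x μ ν = G x ν μ) (hX : ∀ α, DifferentiableAt ℝ (fun y ↦ X y α) x)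
    (hw : ContDiffAt ℝ 2 w x) :
    ∑ μ, fderiv ℝ (fun y ↦ multiplierCurrent G X w y μ) x (E4.basisVector μ) =
      waveOperator G w x * (∑ α, X x α * fderiv ℝ w x (E4.basisVector α)) +
        multiplierBulk G X w x := by
  -- abbreviations
  set P : Fin 4 → E4 → ℝ := fun κ y ↦ fderiv ℝ w y (E4.basisVector κ) with hP
  set A : Fin 4 → E4 → ℝ := fun μ y ↦ ∑ ν, G y μ ν * P ν y with hA
  set V : E4 → ℝ := fun y ↦ ∑ α, X y α * P α y with hV
  set Q : E4 → ℝ := fun y ↦ ∑ α, ∑ β, G y α β * P α y * P β y with hQ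
  set H : Fin 4 → Fin 4 → ℝ := fun μ β ↦ fderiv ℝ (fderiv ℝ w) x (E4.basisVector μ)
    (E4.basisVector β) with hH
  have hw2 : DifferentiableAt ℝ (fderiv ℝ w) x :=
    (hw.fderiv_right (m := 1) le_rfl).differentiableAt one_ne_zero
  have hHsymm : ∀ μ ν, H μ ν = H ν μ := fun μ ν ↦ (hw.isSymmSndFDerivAt (by simp)).eq _ _
  -- derivative data
  have hdP : ∀ κ, HasFDerivAt (P κ) ((fderiv ℝ (fderiv ℝ w) x).flip (E4.basisVector κ)) x := by
    intro κ
    have := hw2.hasFDerivAt.clm_apply (hasFDerivAt_const (E4.basisVector κ) x)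
    simpa using this
  have hdg : ∀ μ ν, HasFDerivAt (fun y ↦ G y μ ν) (fderiv ℝ (fun y ↦ G y μ ν) x) x :=
    fun μ ν ↦ (hG μ ν).hasFDerivAt
  have hdX : ∀ α, HasFDerivAt (fun y ↦ X y α) (fderiv ℝ (fun y ↦ X y α) x) x :=
    fun α ↦ (hX α).hasFDerivAt
  have hdA : ∀ μ, HasFDerivAt (A μ) (∑ ν, (G x μ ν • (fderiv ℝ (fderiv ℝ w) x).flip
      (E4.basisVector ν) + P ν x • fderiv ℝ (fun y ↦ G y μ ν) x)) x :=
    fun μ ↦ HasFDerivAt.fun_sum fun ν _ ↦ (hdg μ ν).mul (hdP ν)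
  have hdV : HasFDerivAt V (∑ α, (X x α • (fderiv ℝ (fderiv ℝ w) x).flip
      (E4.basisVector α) + P α x • fderiv ℝ (fun y ↦ X y α) x)) x :=
    HasFDerivAt.fun_sum fun α _ ↦ (hdX α).mul (hdP α)
  have hdQ : HasFDerivAt Q (∑ α, ∑ β,
      ((G x α β * P α x) • (fderiv ℝ (fderiv ℝ w) x).flip (E4.basisVector β) +
        P β x • (G x α β • (fderiv ℝ (fderiv ℝ w) x).flip (E4.basisVector α) +
          P α x • fderiv ℝ (fun y ↦ G y α β) x))) x :=
    HasFDerivAt.fun_sum (u := Finset.univ) fun α (_ : α ∈ Finset.univ) ↦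
      HasFDerivAt.fun_sum (u := Finset.univ) fun β (_ : β ∈ Finset.univ) ↦
        ((hdg α β).mul (hdP α)).mul (hdP β)
  -- the current, componentwise, as a combination of `A μ`, `V`, `X _ μ`, `Q`
  have hJ : ∀ μ, (fun y ↦ multiplierCurrent G X w y μ) =
      fun y ↦ A μ y * V y - 2⁻¹ * X y μ * Q y := fun μ ↦ rfl
  have hdJ : ∀ μ, HasFDerivAt (fun y ↦ multiplierCurrent G X w y μ)
      (A μ x • (∑ α, (X x α • (fderiv ℝ (fderiv ℝ w) x).flip (E4.basisVector α) +
          P α x • fderiv ℝ (fun y ↦ X y α) x)) +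
        V x • fderiv ℝ (A μ) x -
        ((2⁻¹ * X x μ) • (∑ α, ∑ β,
            ((G x α β * P α x) • (fderiv ℝ (fderiv ℝ w) x).flip (E4.basisVector β) +
              P β x • (G x α β • (fderiv ℝ (fderiv ℝ w) x).flip (E4.basisVector α) +
                P α x • fderiv ℝ (fun y ↦ G y α β) x))) +
          Q x • ((2⁻¹ : ℝ) • fderiv ℝ (fun y ↦ X y μ) x))) x := by
    intro μ
    rw [hJ μ]
    exact ((hdA μ).differentiableAt.hasFDerivAt.mul hdV).sub
      (((hdX μ).const_mul 2⁻¹).mul hdQ)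
  -- the wave operator is `∑_μ ∂_μ A μ`
  have hbox : waveOperator G w x = ∑ μ, fderiv ℝ (A μ) x (E4.basisVector μ) := rfl
  rw [hbox]
  simp only [fun μ ↦ (hdJ μ).fderiv]
  simp only [sub_apply, add_apply, smul_apply, sum_apply, smul_eq_mul,
    ContinuousLinearMap.flip_apply]
  -- name the second derivatives
  have hHμ : ∀ μ β, fderiv ℝ (fderiv ℝ w) x (E4.basisVector μ) (E4.basisVector β) = H μ β :=
    fun μ β ↦ rfl
  simp only [hHμ]
  -- the remaining identity is pure index algebra (`sum_fderiv_multiplierCurrent_aux`)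
  rw [multiplierBulk]
  simp only [hA, hQ, hP, hV]
  exact sum_fderiv_multiplierCurrent_aux (G x) H
    (fun μ α β ↦ fderiv ℝ (fun y ↦ G y α β) x (E4.basisVector μ)) (X x)
    (fun μ β ↦ fderiv ℝ (fun y ↦ X y β) x (E4.basisVector μ))
    (fun ν ↦ fderiv ℝ w x (E4.basisVector ν))
    (fun μ ↦ fderiv ℝ (fun y ↦ ∑ ν, G y μ ν * fderiv ℝ w y (E4.basisVector ν)) x
      (E4.basisVector μ)) hsymm hHsymm

/-- **Conservation of the `∂_0`-energy for stationary coefficients.** If `G` is differentiable and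
symmetric at `x` with `∂_0 G^{αβ}(x) = 0` and `w` is `C²` at `x`, the current of the coordinate
vector field `∂_0` (components `δ^α_0`) satisfies `∑_μ ∂_μ (J^{∂_0})^μ = (□_G w) ∂_0w`; in
particular it is divergence-free for solutions of `□_G w = 0` (`K^T = 0` for the Killing field
`T`; DRSR arXiv:1402.7034, §2.3; for the Kerr metric this is `Kerr.sum_fderiv_tCurrent`).
[cite: DafermosRodnianskiShlapentokhrothman2014, §2.3.2] -/
theorem sum_fderiv_multiplierCurrent_timeTranslation {G : E4 → Fin 4 → Fin 4 → ℝ} {w : E4 → ℝ}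
    {x : E4} (hG : ∀ μ ν, DifferentiableAt ℝ (fun y ↦ G y μ ν) x)
    (hsymm : ∀ μ ν, G x μ ν = G x ν μ)
    (hstat : ∀ α β, fderiv ℝ (fun y ↦ G y α β) x (E4.basisVector 0) = 0)
    (hw : ContDiffAt ℝ 2 w x) :
    ∑ μ, fderiv ℝ (fun y ↦ multiplierCurrent G (fun _ ν ↦ if ν = 0 then (1 : ℝ) else 0) w y μ) x
        (E4.basisVector μ) =
      waveOperator G w x * fderiv ℝ w x (E4.basisVector 0) := by
  have hX : ∀ α : Fin 4, DifferentiableAt ℝ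
      (fun y : E4 ↦ (fun (_ : E4) (ν : Fin 4) ↦ if ν = 0 then (1 : ℝ) else 0) y α) x :=
    fun α ↦ differentiableAt_const _
  have hX0 : ∀ α : Fin 4,
      fderiv ℝ (fun y : E4 ↦ (fun (_ : E4) (ν : Fin 4) ↦ if ν = 0 then (1 : ℝ) else 0) y α) x = 0 :=
    fun α ↦ by simp
  rw [sum_fderiv_multiplierCurrent hG hsymm hX hw, multiplierBulk_of_fderiv_eq_zero G w hX0]
  simp [hstat]

/-! ### The Lagrangian current -/

/-- Index symmetry: `∑_μ q_μ ∑_ν g^{μν} p_ν = ∑_μ p_μ ∑_ν g^{μν} q_ν` for symmetric `g`. [folklore] -/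
theorem sum_mul_sum_mul_comm (g : Fin 4 → Fin 4 → ℝ) (p q : Fin 4 → ℝ)
    (hg : ∀ μ ν, g μ ν = g ν μ) :
    ∑ μ, q μ * ∑ ν, g μ ν * p ν = ∑ μ, p μ * ∑ ν, g μ ν * q ν := by
  simp only [Finset.mul_sum]
  rw [Finset.sum_comm]
  refine Finset.sum_congr rfl fun μ _ ↦ Finset.sum_congr rfl fun ν _ ↦ ?_
  rw [hg ν μ]
  ring

/-- **The divergence of the Lagrangian current.** For `G` differentiable and symmetric at `x` and
`ϖ`, `w` of class `C²` at `x`,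
`∑_μ ∂_μ L^μ (x) = ϖ Q + ϖ w □_G w − ½ (□_G ϖ) w²` with `Q = ∑_{αβ} G^{αβ} ∂_αw ∂_βw`
(the cross terms `w ∑ (∂_μϖ) G^{μν} ∂_νw` cancel by the symmetry of `G`). With `J^{X,ϖ} = J^X + ¼ L`
this gives the modified bulk `K^{X,ϖ} = K^X + ¼ ϖ ∇^αw∇_αw − ⅛ (□_g ϖ) w²` and the modified
source term `(X(w) + ¼ ϖ w) □_g w` of DRSR arXiv:1402.7034, §2.3.1.
[cite: DafermosRodnianskiShlapentokhrothman2014, §2.3.1] -/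
theorem sum_fderiv_lagrangianCurrent {G : E4 → Fin 4 → Fin 4 → ℝ} {ϖ w : E4 → ℝ} {x : E4}
    (hG : ∀ μ ν, DifferentiableAt ℝ (fun y ↦ G y μ ν) x) (hsymm : ∀ μ ν, G x μ ν = G x ν μ)
    (hϖ : ContDiffAt ℝ 2 ϖ x) (hw : ContDiffAt ℝ 2 w x) :
    ∑ μ, fderiv ℝ (fun y ↦ lagrangianCurrent G ϖ w y μ) x (E4.basisVector μ) =
      ϖ x * (∑ α, ∑ β, G x α β * fderiv ℝ w x (E4.basisVector α) *
          fderiv ℝ w x (E4.basisVector β)) +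
        ϖ x * w x * waveOperator G w x - 2⁻¹ * waveOperator G ϖ x * w x ^ 2 := by
  -- abbreviations: `A μ = ∑_ν G^{μν} ∂_ν w`, `B μ = ∑_ν G^{μν} ∂_ν ϖ`
  set A : Fin 4 → E4 → ℝ := fun μ y ↦ ∑ ν, G y μ ν * fderiv ℝ w y (E4.basisVector ν) with hA
  set B : Fin 4 → E4 → ℝ := fun μ y ↦ ∑ ν, G y μ ν * fderiv ℝ ϖ y (E4.basisVector ν) with hB
  have hw1 : DifferentiableAt ℝ w x := hw.differentiableAt (by simp)
  have hϖ1 : DifferentiableAt ℝ ϖ x := hϖ.differentiableAt (by simp)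
  have hdcoord : ∀ {u : E4 → ℝ}, ContDiffAt ℝ 2 u x → ∀ κ,
      DifferentiableAt ℝ (fun y ↦ fderiv ℝ u y (E4.basisVector κ)) x := by
    intro u hu κ
    have hu2 : DifferentiableAt ℝ (fderiv ℝ u) x :=
      (hu.fderiv_right (m := 1) le_rfl).differentiableAt one_ne_zero
    exact hu2.clm_apply (differentiableAt_const _)
  have hdA : ∀ μ, DifferentiableAt ℝ (A μ) x := fun μ ↦
    DifferentiableAt.fun_sum fun ν _ ↦ (hG μ ν).mul (hdcoord hw ν)
  have hdB : ∀ μ, DifferentiableAt ℝ (B μ) x := fun μ ↦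
    DifferentiableAt.fun_sum fun ν _ ↦ (hG μ ν).mul (hdcoord hϖ ν)
  -- the current, componentwise
  have hL : ∀ μ, (fun y ↦ lagrangianCurrent G ϖ w y μ) =
      fun y ↦ ϖ y * w y * A μ y - 2⁻¹ * w y ^ 2 * B μ y := fun μ ↦ rfl
  have hdL : ∀ μ, fderiv ℝ (fun y ↦ lagrangianCurrent G ϖ w y μ) x (E4.basisVector μ) =
      (ϖ x * fderiv ℝ w x (E4.basisVector μ) + w x * fderiv ℝ ϖ x (E4.basisVector μ)) * A μ x +
        ϖ x * w x * fderiv ℝ (A μ) x (E4.basisVector μ) -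
        (2⁻¹ * (2 * w x * fderiv ℝ w x (E4.basisVector μ)) * B μ x +
          2⁻¹ * w x ^ 2 * fderiv ℝ (B μ) x (E4.basisVector μ)) := by
    intro μ
    rw [hL μ]
    have h1 : HasFDerivAt (fun y ↦ ϖ y * w y) (ϖ x • fderiv ℝ w x + w x • fderiv ℝ ϖ x) x :=
      hϖ1.hasFDerivAt.mul hw1.hasFDerivAt
    have h2 : HasFDerivAt (fun y ↦ w y ^ 2) ((2 * w x) • fderiv ℝ w x) x := by
      have := hw1.hasFDerivAt.pow 2
      simpa using this
    have h12 := (h1.mul (hdA μ).hasFDerivAt).sub ((h2.const_mul 2⁻¹).mul (hdB μ).hasFDerivAt)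
    have h12' : HasFDerivAt (fun y ↦ ϖ y * w y * A μ y - 2⁻¹ * w y ^ 2 * B μ y) _ x := h12
    rw [h12'.fderiv]
    simp only [sub_apply, add_apply, smul_apply, smul_eq_mul]
    ring
  simp only [hdL]
  -- the two wave operators are `∑_μ ∂_μ A μ` and `∑_μ ∂_μ B μ`
  have hboxw : waveOperator G w x = ∑ μ, fderiv ℝ (A μ) x (E4.basisVector μ) := rfl
  have hboxϖ : waveOperator G ϖ x = ∑ μ, fderiv ℝ (B μ) x (E4.basisVector μ) := rfl
  rw [hboxw, hboxϖ]
  -- the cross terms cancel by symmetry of `G`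
  have hcross : ∑ μ, fderiv ℝ ϖ x (E4.basisVector μ) * A μ x =
      ∑ μ, fderiv ℝ w x (E4.basisVector μ) * B μ x := by
    simp only [hA, hB]
    exact sum_mul_sum_mul_comm (G x) (fun ν ↦ fderiv ℝ w x (E4.basisVector ν))
      (fun ν ↦ fderiv ℝ ϖ x (E4.basisVector ν)) hsymm
  -- `∑_μ ∂_μw A^μ = Q`
  have hQ : ∑ μ, fderiv ℝ w x (E4.basisVector μ) * A μ x =
      ∑ α, ∑ β, G x α β * fderiv ℝ w x (E4.basisVector α) * fderiv ℝ w x (E4.basisVector β) := by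
    simp only [hA, Finset.mul_sum]
    exact Finset.sum_congr rfl fun α _ ↦ Finset.sum_congr rfl fun β _ ↦ by ring
  have hsplit : ∑ μ, ((ϖ x * fderiv ℝ w x (E4.basisVector μ) +
      w x * fderiv ℝ ϖ x (E4.basisVector μ)) * A μ x +
        ϖ x * w x * fderiv ℝ (A μ) x (E4.basisVector μ) -
        (2⁻¹ * (2 * w x * fderiv ℝ w x (E4.basisVector μ)) * B μ x +
          2⁻¹ * w x ^ 2 * fderiv ℝ (B μ) x (E4.basisVector μ))) =
      ϖ x * ∑ μ, fderiv ℝ w x (E4.basisVector μ) * A μ x +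
        w x * ∑ μ, fderiv ℝ ϖ x (E4.basisVector μ) * A μ x +
        ϖ x * w x * ∑ μ, fderiv ℝ (A μ) x (E4.basisVector μ) -
        w x * ∑ μ, fderiv ℝ w x (E4.basisVector μ) * B μ x -
        2⁻¹ * w x ^ 2 * ∑ μ, fderiv ℝ (B μ) x (E4.basisVector μ) := by
    simp only [Finset.mul_sum, ← Finset.sum_add_distrib, ← Finset.sum_sub_distrib]
    exact Finset.sum_congr rfl fun μ _ ↦ by ring
  rw [hsplit, hcross, hQ]
  ring

/-- **The divergence of the modified current `J^{X,ϖ} = J^X + ¼ L`** (DRSR arXiv:1402.7034,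
§2.3.1: `J^{V,w}_μ = J^V_μ + ⅛ w∂_μ(Ψ²) − ⅛ (∂_μw)Ψ²`): under the hypotheses of
`sum_fderiv_multiplierCurrent` and with `ϖ` of class `C²` at `x`,
`∑_μ ∂_μ (J^X + ¼ L)^μ = (X(w) + ¼ ϖ w) □_G w + (K^X + ¼ ϖ Q − ⅛ (□_G ϖ) w²)`, i.e. the bulk is
`K^{X,ϖ} = K^X + ¼ ϖ ∇^αw ∇_αw − ⅛ (□ϖ) w²` and the source term is `𝓔^{X,ϖ}`-type, as printed.
[cite: DafermosRodnianskiShlapentokhrothman2014, §2.3.1] -/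
theorem sum_fderiv_modifiedCurrent {G : E4 → Fin 4 → Fin 4 → ℝ} {X : E4 → Fin 4 → ℝ}
    {ϖ w : E4 → ℝ} {x : E4} (hG : ∀ μ ν, DifferentiableAt ℝ (fun y ↦ G y μ ν) x)
    (hsymm : ∀ μ ν, G x μ ν = G x ν μ) (hX : ∀ α, DifferentiableAt ℝ (fun y ↦ X y α) x)
    (hϖ : ContDiffAt ℝ 2 ϖ x) (hw : ContDiffAt ℝ 2 w x) :
    ∑ μ, fderiv ℝ (fun y ↦ multiplierCurrent G X w y μ + 4⁻¹ * lagrangianCurrent G ϖ w y μ) x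
        (E4.basisVector μ) =
      ((∑ α, X x α * fderiv ℝ w x (E4.basisVector α)) + 4⁻¹ * (ϖ x * w x)) *
          waveOperator G w x +
        (multiplierBulk G X w x +
          4⁻¹ * (ϖ x * ∑ α, ∑ β, G x α β * fderiv ℝ w x (E4.basisVector α) *
            fderiv ℝ w x (E4.basisVector β)) -
          8⁻¹ * waveOperator G ϖ x * w x ^ 2) := by
  -- differentiability of the two currents at `x` (from the `HasFDerivAt` data of the two
  -- divergence theorems, re-derived cheaply)
  have hw1 : DifferentiableAt ℝ w x := hw.differentiableAt (by simp)
  have hϖ1 : DifferentiableAt ℝ ϖ x := hϖ.differentiableAt (by simp)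
  have hdcoord : ∀ {u : E4 → ℝ}, ContDiffAt ℝ 2 u x → ∀ κ,
      DifferentiableAt ℝ (fun y ↦ fderiv ℝ u y (E4.basisVector κ)) x := by
    intro u hu κ
    have hu2 : DifferentiableAt ℝ (fderiv ℝ u) x :=
      (hu.fderiv_right (m := 1) le_rfl).differentiableAt one_ne_zero
    exact hu2.clm_apply (differentiableAt_const _)
  have hdA : ∀ μ, DifferentiableAt ℝ
      (fun y ↦ ∑ ν, G y μ ν * fderiv ℝ w y (E4.basisVector ν)) x := fun μ ↦
    DifferentiableAt.fun_sum fun ν _ ↦ (hG μ ν).mul (hdcoord hw ν)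
  have hdB : ∀ μ, DifferentiableAt ℝ
      (fun y ↦ ∑ ν, G y μ ν * fderiv ℝ ϖ y (E4.basisVector ν)) x := fun μ ↦
    DifferentiableAt.fun_sum fun ν _ ↦ (hG μ ν).mul (hdcoord hϖ ν)
  have hdV : DifferentiableAt ℝ (fun y ↦ ∑ α, X y α * fderiv ℝ w y (E4.basisVector α)) x :=
    DifferentiableAt.fun_sum fun α _ ↦ (hX α).mul (hdcoord hw α)
  have hdQ : DifferentiableAt ℝ (fun y ↦ ∑ α, ∑ β, G y α β * fderiv ℝ w y (E4.basisVector α) *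
      fderiv ℝ w y (E4.basisVector β)) x :=
    DifferentiableAt.fun_sum fun α _ ↦ DifferentiableAt.fun_sum fun β _ ↦
      ((hG α β).mul (hdcoord hw α)).mul (hdcoord hw β)
  have hdJ : ∀ μ, DifferentiableAt ℝ (fun y ↦ multiplierCurrent G X w y μ) x := fun μ ↦
    ((hdA μ).mul hdV).sub (((hX μ).const_mul _).mul hdQ)
  have hdL : ∀ μ, DifferentiableAt ℝ (fun y ↦ lagrangianCurrent G ϖ w y μ) x := fun μ ↦
    ((hϖ1.mul hw1).mul (hdA μ)).sub (((hw1.pow 2).const_mul _).mul (hdB μ))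
  have hsum : ∀ μ, fderiv ℝ (fun y ↦ multiplierCurrent G X w y μ +
      4⁻¹ * lagrangianCurrent G ϖ w y μ) x (E4.basisVector μ) =
      fderiv ℝ (fun y ↦ multiplierCurrent G X w y μ) x (E4.basisVector μ) +
        4⁻¹ * fderiv ℝ (fun y ↦ lagrangianCurrent G ϖ w y μ) x (E4.basisVector μ) := by
    intro μ
    have h := (hdJ μ).hasFDerivAt.add ((hdL μ).hasFDerivAt.const_mul (4⁻¹ : ℝ))
    have h' : HasFDerivAt
        (fun y ↦ multiplierCurrent G X w y μ + 4⁻¹ * lagrangianCurrent G ϖ w y μ) _ x := h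
    rw [h'.fderiv]
    simp only [add_apply, smul_apply, smul_eq_mul]
  simp only [hsum, Finset.sum_add_distrib, ← Finset.mul_sum]
  rw [sum_fderiv_multiplierCurrent hG hsymm hX hw, sum_fderiv_lagrangianCurrent hG hsymm hϖ hw]
  ring

end KerrSchild

end Literature.Geometry.Lorentzian
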